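import Summits.MatrixMultiplication.MatrixMultiplication.Theorems.FidelityWitnessesSixEighthsAtFive

/-!
# `FidelityWitnesses.LinearDefectLaw` (stmt-MatrixMultiplication-14039) — capture form, I: frames and the rung ↔ cap dictionary

Support file for item `stmt-MatrixMultiplication-14039` (`LinearDefectLaw`) of route
`MatrixMultiplication/FidelityWitnesses`.

For an orthonormal `k`-frame `e` of `ℂ^{P2} ⊗ ℂ^{P2}` (`P2 = Fin 2 × Fin 2`, inner product `Σ conj f · g`) write
`m(e_s) : a ↦ Σ_μ e_s (a.1,μ) (μ,a.2)` (matrix multiplication of the two legs) and `cap e := Σ_s ‖m(e_s)‖²`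
(`= 2 tr(P_E Π_W)`, `E = span e`, `W` the span of the four output slices of `⟨2,2,2⟩`).  The filed window rungs of
the law at `n = 2` already have kernel-checked reductions to `cap` bounds on product planes
(`SevenEighthsLaw.stub_sliceElimination`, `sixEighthsAtFive_of_capHardRegime`); this file makes the dictionary
uniform in the rank `k` and TWO-SIDED:

* `productFrame` (any `k ≤ 16`): `k` products `u_l ⊗ v_l` sit in an honest product `k`-plane with an orthonormal
  basis (the tree's `k = 5, 6` versions, uniform in `k`);
* `cap_le_two_mul_finrank`: `cap e ≤ 2 · dim span m(e)` (Bessel, `m m* = 2`; the tree's `stub_capEasyRegime` is the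
  case `dim ≤ 3`), hence `cap e ≤ 8` (`cap_le_eight`) and `cap e ≤ 2k` (`cap_le_two_mul`);
* `cap_le_of_rung` (converse direction, new): a fidelity bound `|⟨S,⟨2,2,2⟩⟩|² ≤ C‖S‖²` on rank-`≤ k` tensors forces
  `cap e ≤ C` for every orthonormal `k`-frame in a product `k`-plane — witness `S = Σ_s conj(m(e_s)) ⊗ e_s`, of rank
  `≤ k`, with `⟨S,T⟩ = ‖S‖² = cap e`;
* `rung_of_cap`, `rung_iff_cap` (registered stub `stub_rungIffCap`): for `k ≤ 16`, `C ≥ 0`,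
  `(M(2,k) ≤ C) ↔ (cap e ≤ C on honest product k-planes)`.

Part II (`…LinearDefectLawCapFour`) applies this at `k = 4` and to the whole `n = 2` law.
-/

noncomputable section

namespace Summit.MatrixMultiplication.MatrixMultiplication.Theorems.LinearDefectLaw.Caps

open scoped BigOperators ComplexConjugate InnerProductSpace
open Literature.Computability.AlgebraicComplexity InnerProductSpace
open Summit.MatrixMultiplication.MatrixMultiplication.Theorems.SevenEighthsLaw
  (slice_sum_matMulTensor parseval_slice stub_sliceElimination
    stub_capEasyRegime_bessel stub_capEasyRegime_adjoint stub_capEasyRegime_adjoint_norm)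

set_option linter.dupNamespace false

/-! ## Product frames for `k ≤ 16` products -/

/-- Exchange/padding lemma: if the family `w` spans the space, then any index set `A` with at
most `n ≤ finrank` elements is captured by the span of `w` on some `n`-element index set `C` on
which `w` is linearly independent. [folklore] -/
private theorem caps_exists_linearIndepOn_ncard_eq {K E ι : Type*} [Field K]
    [AddCommGroup E] [Module K E] [Finite ι] (w : ι → E) (A : Set ι) (n : ℕ)
    (hA : A.ncard ≤ n) (hn : n ≤ Module.finrank K E)
    (hw : ⊤ ≤ Submodule.span K (Set.range w)) :
    ∃ C : Set ι, C.ncard = n ∧ LinearIndepOn K w C ∧ w '' A ⊆ Submodule.span K (w '' C) := by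
  obtain ⟨s₀, hs₀A, -, hAs₀, hs₀li⟩ :=
    exists_linearIndepOn_extension (linearIndepOn_empty K w) (Set.empty_subset A)
  obtain ⟨B, -, hs₀B, hB, hBli⟩ := exists_linearIndepOn_extension hs₀li (Set.subset_univ s₀)
  have hs₀n : s₀.ncard ≤ n := (Set.ncard_le_ncard hs₀A).trans hA
  have hBspan : ⊤ ≤ Submodule.span K (Set.range fun x : B => w x) := by
    rw [← Set.image_eq_range]
    refine hw.trans (Submodule.span_le.mpr ?_)
    rw [← Set.image_univ]
    exact hB
  have hcard : Module.finrank K E = B.ncard := by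
    rw [Module.finrank_eq_nat_card_basis (Module.Basis.mk hBli.linearIndependent hBspan),
      Nat.card_coe_set_eq]
  obtain ⟨C, hs₀C, hCB, hC⟩ := Set.exists_subsuperset_card_eq hs₀B hs₀n (hcard ▸ hn)
  exact ⟨C, hC, hBli.mono hCB, hAs₀.trans (Submodule.span_mono (Set.image_mono hs₀C))⟩

/-- **Product frame for `k ≤ 16` products.** For any `k ≤ 16` products `u l ⊗ v l` in
`(Fin 2 × Fin 2) → (Fin 2 × Fin 2) → ℂ` there are `k` products `u' l ⊗ v' l` and an orthonormal
(for `⟨f, g⟩ = Σ_b Σ_c conj (f b c) * g b c`) `k`-frame `e` with every `e s` in the span of the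
`u' l ⊗ v' l` and every `u l ⊗ v l` in the span of `e` (pad a maximal independent subfamily by
standard products, Gram–Schmidt in `EuclideanSpace ℂ (P2 × P2)`); uniform-in-`k` form of the tree's
`sixEighthsAtFive_productFrame` / `SevenEighthsLaw.stub_productFrame`. [folklore] -/
theorem productFrame {k : ℕ} (hk : k ≤ 16) (u v : Fin k → (Fin 2 × Fin 2) → ℂ) :
    ∃ (u' v' : Fin k → (Fin 2 × Fin 2) → ℂ) (e : Fin k → (Fin 2 × Fin 2) → (Fin 2 × Fin 2) → ℂ),
      (∀ s t : Fin k, (∑ b, ∑ c, conj (e s b c) * e t b c) = if s = t then 1 else 0) ∧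
      (∀ s, e s ∈ Submodule.span ℂ (Set.range fun l : Fin k => fun b c => u' l b * v' l c)) ∧
      ∀ l : Fin k, (fun b c => u l b * v l c) ∈ Submodule.span ℂ (Set.range e) := by
  classical
  -- factor families indexed by `Fin k ⊕ (P2 × P2)`: the given products, then the standard ones
  let X : Fin k ⊕ (Fin 2 × Fin 2) × (Fin 2 × Fin 2) → (Fin 2 × Fin 2) → ℂ :=
    Sum.elim u fun bc b => if b = bc.1 then 1 else 0
  let Y : Fin k ⊕ (Fin 2 × Fin 2) × (Fin 2 × Fin 2) → (Fin 2 × Fin 2) → ℂ :=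
    Sum.elim v fun bc c => if c = bc.2 then 1 else 0
  -- the products, as vectors of the Euclidean space on `P2 × P2`
  let w : Fin k ⊕ (Fin 2 × Fin 2) × (Fin 2 × Fin 2) →
      EuclideanSpace ℂ ((Fin 2 × Fin 2) × (Fin 2 × Fin 2)) :=
    fun i => WithLp.toLp 2 fun bc => X i bc.1 * Y i bc.2
  -- back to curried functions (a linear map)
  let ψ : EuclideanSpace ℂ ((Fin 2 × Fin 2) × (Fin 2 × Fin 2)) →ₗ[ℂ]
      (Fin 2 × Fin 2) → (Fin 2 × Fin 2) → ℂ :=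
    { toFun := fun x b c => x (b, c)
      map_add' := fun _ _ => rfl
      map_smul' := fun _ _ => rfl }
  -- the standard products are the standard basis vectors
  have hstd : ∀ bc, w (Sum.inr bc) = EuclideanSpace.single bc 1 := by
    rintro ⟨b, c⟩
    ext ⟨b', c'⟩
    simp only [w, X, Y, Sum.elim_inr, PiLp.single_apply, Prod.mk.injEq]
    by_cases h1 : b' = b <;> by_cases h2 : c' = c <;> simp [h1, h2]
  have hw : ⊤ ≤ Submodule.span ℂ (Set.range w) := by
    rw [← (PiLp.basisFun 2 ℂ ((Fin 2 × Fin 2) × (Fin 2 × Fin 2))).span_eq]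
    refine Submodule.span_mono ?_
    rintro _ ⟨bc, rfl⟩
    exact ⟨Sum.inr bc, by rw [PiLp.basisFun_apply]; exact hstd bc⟩
  have hA : (Set.range (Sum.inl : Fin k → Fin k ⊕ (Fin 2 × Fin 2) × (Fin 2 × Fin 2))).ncard ≤ k := by
    rw [Set.ncard_range_of_injective Sum.inl_injective]
    simp
  have hfin : Module.finrank ℂ (EuclideanSpace ℂ ((Fin 2 × Fin 2) × (Fin 2 × Fin 2))) = 16 := by
    simp
  have h5 : k ≤ Module.finrank ℂ (EuclideanSpace ℂ ((Fin 2 × Fin 2) × (Fin 2 × Fin 2))) := by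
    rw [hfin]; exact hk
  obtain ⟨C, hC, hCli, hAC⟩ :=
    caps_exists_linearIndepOn_ncard_eq w (Set.range Sum.inl) k hA h5 hw
  -- enumerate `C` by `Fin k`
  have hCcard : Nat.card C = k := by rw [Nat.card_coe_set_eq, hC]
  let σ : Fin k ≃ C := (Finite.equivFinOfCardEq hCcard).symm
  let p : Fin k → EuclideanSpace ℂ ((Fin 2 × Fin 2) × (Fin 2 × Fin 2)) := fun l => w (σ l)
  have hpli : LinearIndependent ℂ p := hCli.linearIndependent.comp σ σ.injective
  have hpC : w '' C ⊆ Set.range p := by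
    rintro _ ⟨i, hi, rfl⟩
    exact ⟨σ.symm ⟨i, hi⟩, by simp [p, σ]⟩
  -- Gram–Schmidt
  have he' : Orthonormal ℂ (gramSchmidtNormed ℂ p) := gramSchmidtNormed_orthonormal hpli
  have hspan : Submodule.span ℂ (Set.range (gramSchmidtNormed ℂ p)) =
      Submodule.span ℂ (Set.range p) := by
    rw [span_gramSchmidtNormed_range, span_gramSchmidt]
  have key : ∀ x y : EuclideanSpace ℂ ((Fin 2 × Fin 2) × (Fin 2 × Fin 2)),
      (∑ b, ∑ c, conj (x (b, c)) * y (b, c)) = inner ℂ x y := by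
    intro x y
    simp only [PiLp.inner_apply, RCLike.inner_apply]
    rw [Fintype.sum_prod_type (f := fun bc => y bc * conj (x bc))]
    exact Finset.sum_congr rfl fun b _ => Finset.sum_congr rfl fun c _ => mul_comm _ _
  refine ⟨fun l => X (σ l), fun l => Y (σ l), fun s b c => gramSchmidtNormed ℂ p s (b, c),
    ?_, ?_, ?_⟩
  · intro s t
    rw [← orthonormal_iff_ite.mp he' s t]
    exact key _ _
  · intro s
    have hs : gramSchmidtNormed ℂ p s ∈ Submodule.span ℂ (Set.range p) := by
      rw [← hspan]
      exact Submodule.subset_span ⟨s, rfl⟩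
    have := Submodule.apply_mem_span_image_of_mem_span ψ hs
    rw [← Set.range_comp] at this
    exact this
  · intro l
    have hl : w (Sum.inl l) ∈ Submodule.span ℂ (Set.range (gramSchmidtNormed ℂ p)) := by
      rw [hspan]
      exact Submodule.span_mono hpC (hAC ⟨Sum.inl l, ⟨l, rfl⟩, rfl⟩)
    have := Submodule.apply_mem_span_image_of_mem_span ψ hl
    rw [← Set.range_comp] at this
    exact this

/-! ## Capture is at most `2 · dim span m(e)` -/

/-- **`cap e ≤ 2 · dim span m(e)`.**  For an orthonormal `k`-frame `e`, the multiplied vectors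
`m(e_s) : a ↦ Σ_μ e_s (a.1,μ) (μ,a.2)` have `Σ_s ‖m(e_s)‖² ≤ 2 · dim span{m(e_s)}`: Parseval inside the span
against an orthonormal basis `q_j`, and `Σ_s |⟨q_j, m(e_s)⟩|² = Σ_s |⟨m* q_j, e_s⟩|² ≤ ‖m* q_j‖² = 2` (Bessel,
`m m* = 2`).  Uniform form of the tree's `SevenEighthsLaw.stub_capEasyRegime` (the case `dim ≤ 3`). [folklore] -/
theorem cap_le_two_mul_finrank {k : ℕ} (e : Fin k → (Fin 2 × Fin 2) → (Fin 2 × Fin 2) → ℂ)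
    (he : ∀ s t : Fin k, (∑ b, ∑ c, conj (e s b c) * e t b c) = if s = t then 1 else 0) :
    ∑ s, ∑ a : Fin 2 × Fin 2, ‖∑ m : Fin 2, e s (a.1, m) (m, a.2)‖ ^ 2 ≤
      2 * (Module.finrank ℂ (Submodule.span ℂ (Set.range fun s : Fin k =>
        fun a : Fin 2 × Fin 2 => ∑ μ : Fin 2, e s (a.1, μ) (μ, a.2))) : ℝ) := by
  classical
  -- the multiplied vectors, as plain functions and inside `EuclideanSpace ℂ P2`
  set v0 : Fin k → (Fin 2 × Fin 2) → ℂ := fun s a => ∑ μ : Fin 2, e s (a.1, μ) (μ, a.2) with hv0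
  let M0 : Submodule ℂ ((Fin 2 × Fin 2) → ℂ) := Submodule.span ℂ (Set.range v0)
  let L : ((Fin 2 × Fin 2) → ℂ) →ₗ[ℂ] EuclideanSpace ℂ (Fin 2 × Fin 2) :=
    (WithLp.linearEquiv 2 ℂ ((Fin 2 × Fin 2) → ℂ)).symm.toLinearMap
  let v : Fin k → EuclideanSpace ℂ (Fin 2 × Fin 2) := fun s => L (v0 s)
  let M : Submodule ℂ (EuclideanSpace ℂ (Fin 2 × Fin 2)) := M0.map L
  have hvM : ∀ s, v s ∈ M := fun s => Submodule.mem_map_of_mem (Submodule.subset_span ⟨s, rfl⟩)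
  have hr : Module.finrank ℂ M ≤ Module.finrank ℂ M0 := Submodule.finrank_map_le L M0
  -- an orthonormal basis of `M`
  let b := stdOrthonormalBasis ℂ M
  -- Parseval inside `M`
  have hpars : ∀ s, (∑ a : Fin 2 × Fin 2, ‖∑ m : Fin 2, e s (a.1, m) (m, a.2)‖ ^ 2)
      = ∑ j, ‖⟪(b j : EuclideanSpace ℂ (Fin 2 × Fin 2)), v s⟫_ℂ‖ ^ 2 := by
    intro s
    have h1 := b.sum_sq_norm_inner_right ⟨v s, hvM s⟩
    simp only [Submodule.coe_inner, Submodule.coe_norm] at h1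
    rw [h1, EuclideanSpace.norm_sq_eq]
    rfl
  -- the bound for one unit vector `q` of `M`
  have hq : ∀ j, ∑ s, ‖⟪(b j : EuclideanSpace ℂ (Fin 2 × Fin 2)), v s⟫_ℂ‖ ^ 2 ≤ 2 := by
    intro j
    set q : EuclideanSpace ℂ (Fin 2 × Fin 2) := (b j : EuclideanSpace ℂ (Fin 2 × Fin 2)) with hqdef
    have hq1 : ‖q‖ = 1 := by
      rw [hqdef, ← Submodule.coe_norm]
      exact b.orthonormal.norm_eq_one j
    have hinner : ∀ s, ⟪q, v s⟫_ℂ = ∑ b' : Fin 2 × Fin 2, ∑ c : Fin 2 × Fin 2,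
        conj (if b'.2 = c.1 then q (b'.1, c.2) else 0) * e s b' c := by
      intro s
      rw [← stub_capEasyRegime_adjoint]
      simp only [PiLp.inner_apply, RCLike.inner_apply']
      rfl
    calc ∑ s, ‖⟪q, v s⟫_ℂ‖ ^ 2
        = ∑ s, ‖∑ b' : Fin 2 × Fin 2, ∑ c : Fin 2 × Fin 2,
            conj (if b'.2 = c.1 then q (b'.1, c.2) else 0) * e s b' c‖ ^ 2 := by
          simp_rw [hinner]
      _ ≤ ∑ b' : Fin 2 × Fin 2, ∑ c : Fin 2 × Fin 2,
            ‖(if b'.2 = c.1 then q (b'.1, c.2) else 0 : ℂ)‖ ^ 2 :=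
          stub_capEasyRegime_bessel e he _
      _ = 2 * ∑ a : Fin 2 × Fin 2, ‖q a‖ ^ 2 := stub_capEasyRegime_adjoint_norm _
      _ = 2 * ‖q‖ ^ 2 := by rw [EuclideanSpace.norm_sq_eq]
      _ = 2 := by rw [hq1]; norm_num
  -- summing up
  calc ∑ s, ∑ a : Fin 2 × Fin 2, ‖∑ m : Fin 2, e s (a.1, m) (m, a.2)‖ ^ 2
      = ∑ s, ∑ j, ‖⟪(b j : EuclideanSpace ℂ (Fin 2 × Fin 2)), v s⟫_ℂ‖ ^ 2 :=
        Finset.sum_congr rfl fun s _ => hpars s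
    _ = ∑ j, ∑ s, ‖⟪(b j : EuclideanSpace ℂ (Fin 2 × Fin 2)), v s⟫_ℂ‖ ^ 2 := Finset.sum_comm
    _ ≤ ∑ _j : Fin (Module.finrank ℂ M), (2 : ℝ) := Finset.sum_le_sum fun j _ => hq j
    _ = 2 * (Module.finrank ℂ M : ℝ) := by simp [mul_comm]
    _ ≤ 2 * (Module.finrank ℂ M0 : ℝ) := by
        have h3 : (Module.finrank ℂ M : ℝ) ≤ Module.finrank ℂ M0 := by exact_mod_cast hr
        linarith

/-- `dim span m(e) ≤ 4` (the multiplied vectors live in `ℂ^{P2}`), hence `cap e ≤ 8` for every orthonormal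
frame: the capture form of Cauchy–Schwarz `M(2,r) ≤ 8`. [folklore] -/
theorem cap_le_eight {k : ℕ} (e : Fin k → (Fin 2 × Fin 2) → (Fin 2 × Fin 2) → ℂ)
    (he : ∀ s t : Fin k, (∑ b, ∑ c, conj (e s b c) * e t b c) = if s = t then 1 else 0) :
    ∑ s, ∑ a : Fin 2 × Fin 2, ‖∑ m : Fin 2, e s (a.1, m) (m, a.2)‖ ^ 2 ≤ 8 := by
  have h := cap_le_two_mul_finrank e he
  have h4 : Module.finrank ℂ (Submodule.span ℂ (Set.range fun s : Fin k =>
      fun a : Fin 2 × Fin 2 => ∑ μ : Fin 2, e s (a.1, μ) (μ, a.2))) ≤ 4 := by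
    have := Submodule.finrank_le (Submodule.span ℂ (Set.range fun s : Fin k =>
      fun a : Fin 2 × Fin 2 => ∑ μ : Fin 2, e s (a.1, μ) (μ, a.2)))
    simpa using this
  have h4' : (Module.finrank ℂ (Submodule.span ℂ (Set.range fun s : Fin k =>
      fun a : Fin 2 × Fin 2 => ∑ μ : Fin 2, e s (a.1, μ) (μ, a.2))) : ℝ) ≤ 4 := by
    exact_mod_cast h4
  linarith

/-- `cap e ≤ 2k` for an orthonormal `k`-frame (`dim span m(e) ≤ k`). [folklore] -/
theorem cap_le_two_mul {k : ℕ} (e : Fin k → (Fin 2 × Fin 2) → (Fin 2 × Fin 2) → ℂ)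
    (he : ∀ s t : Fin k, (∑ b, ∑ c, conj (e s b c) * e t b c) = if s = t then 1 else 0) :
    ∑ s, ∑ a : Fin 2 × Fin 2, ‖∑ m : Fin 2, e s (a.1, m) (m, a.2)‖ ^ 2 ≤ 2 * k := by
  have h := cap_le_two_mul_finrank e he
  have hk : Module.finrank ℂ (Submodule.span ℂ (Set.range fun s : Fin k =>
      fun a : Fin 2 × Fin 2 => ∑ μ : Fin 2, e s (a.1, μ) (μ, a.2))) ≤ k := by
    have h0 := finrank_range_le_card (R := ℂ) (fun s : Fin k =>
      fun a : Fin 2 × Fin 2 => ∑ μ : Fin 2, e s (a.1, μ) (μ, a.2))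
    rw [Fintype.card_fin] at h0
    exact h0
  have hk' : (Module.finrank ℂ (Submodule.span ℂ (Set.range fun s : Fin k =>
      fun a : Fin 2 × Fin 2 => ∑ μ : Fin 2, e s (a.1, μ) (μ, a.2))) : ℝ) ≤ k := by
    exact_mod_cast hk
  linarith

/-! ## From a rung to the capture bound: the tensor `Σ_s conj(m(e_s)) ⊗ e_s` -/

/-- The output slices of a sum of `k` triads lie in the span of any frame containing the `k`
products. [folklore] -/
theorem slice_mem_span {k j : ℕ} (e : Fin j → (Fin 2 × Fin 2) → (Fin 2 × Fin 2) → ℂ)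
    (w u v : Fin k → (Fin 2 × Fin 2) → ℂ)
    (hprod : ∀ l : Fin k, (fun b c => u l b * v l c) ∈ Submodule.span ℂ (Set.range e))
    (a : Fin 2 × Fin 2) :
    (∑ i, triad (w i) (u i) (v i)) a ∈ Submodule.span ℂ (Set.range e) := by
  have hslice : (∑ i, triad (w i) (u i) (v i)) a =
      ∑ i, w i a • (fun b c => u i b * v i c : (Fin 2 × Fin 2) → (Fin 2 × Fin 2) → ℂ) := by
    funext b c
    simp [Finset.sum_apply, triad_apply, Pi.smul_apply, smul_eq_mul, mul_assoc]
  rw [hslice]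
  exact Submodule.sum_mem _ fun i _ => Submodule.smul_mem _ _ (hprod i)

/-- **A fidelity bound at rank `k` bounds the capture of product `k`-planes.**  If
`|⟨S,⟨2,2,2⟩⟩|² ≤ C‖S‖²` for every tensor `S` of rank `≤ k` (`C ≥ 0`), then every orthonormal `k`-frame `e`
lying in the span of `k` products has `cap e ≤ C`.  Witness: `S(a,b,c) = Σ_s conj(m(e_s)(a)) · e_s(b,c)` has
rank `≤ k` (each `e_s` is a combination of the products), and `⟨S,T⟩ = ‖S‖² = cap e` (slice pairing
`slice_sum_matMulTensor` and Parseval `parseval_slice` of the tree). [folklore] -/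
theorem cap_le_of_rung {k : ℕ} {C : ℝ} (hC : 0 ≤ C)
    (hrung : ∀ S : (Fin 2 × Fin 2) → (Fin 2 × Fin 2) → (Fin 2 × Fin 2) → ℂ, tensorRank S ≤ k →
      ‖∑ a, ∑ b, ∑ c, S a b c * matMulTensor ℂ 2 2 2 a b c‖ ^ 2 ≤ C * ∑ a, ∑ b, ∑ c, ‖S a b c‖ ^ 2)
    (u v : Fin k → (Fin 2 × Fin 2) → ℂ) (e : Fin k → (Fin 2 × Fin 2) → (Fin 2 × Fin 2) → ℂ)
    (he : ∀ s t : Fin k, (∑ b, ∑ c, conj (e s b c) * e t b c) = if s = t then 1 else 0)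
    (hspan : ∀ s, e s ∈ Submodule.span ℂ (Set.range fun l : Fin k => fun b c => u l b * v l c)) :
    ∑ s, ∑ a : Fin 2 × Fin 2, ‖∑ m : Fin 2, e s (a.1, m) (m, a.2)‖ ^ 2 ≤ C := by
  classical
  -- the multiplied vectors and the witness tensor
  set τ : Fin k → (Fin 2 × Fin 2) → ℂ := fun s a => ∑ m : Fin 2, e s (a.1, m) (m, a.2) with hτ
  set z : (Fin 2 × Fin 2) → Fin k → ℂ := fun a s => conj (τ s a) with hz
  set S : (Fin 2 × Fin 2) → (Fin 2 × Fin 2) → (Fin 2 × Fin 2) → ℂ :=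
    fun a b c => ∑ s, z a s * e s b c with hSdef
  set cap : ℝ := ∑ s, ∑ a : Fin 2 × Fin 2, ‖τ s a‖ ^ 2 with hcap
  have hcap0 : 0 ≤ cap := by positivity
  -- coefficients of the frame vectors in the products
  have hd : ∀ s, ∃ d : Fin k → ℂ,
      (∑ l, d l • (fun b c => u l b * v l c : (Fin 2 × Fin 2) → (Fin 2 × Fin 2) → ℂ)) = e s :=
    fun s => (Submodule.mem_span_range_iff_exists_fun ℂ).mp (hspan s)
  choose d hd using hd
  have hde : ∀ s b c, e s b c = ∑ l, d s l * (u l b * v l c) := by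
    intro s b c
    have := congrFun (congrFun (hd s) b) c
    simpa [Finset.sum_apply, Pi.smul_apply, smul_eq_mul] using this.symm
  -- rank ≤ k
  have hrank : tensorRank S ≤ k := by
    refine tensorRank_le_of_eq_sum (fun l a => ∑ s, z a s * d s l) u v ?_
    funext a b c
    simp only [hSdef, Finset.sum_apply, triad_apply]
    calc ∑ s, z a s * e s b c = ∑ s, ∑ l, z a s * d s l * (u l b * v l c) := by
          refine Finset.sum_congr rfl fun s _ => ?_
          rw [hde s b c, Finset.mul_sum]
          exact Finset.sum_congr rfl fun l _ => by ring
      _ = ∑ l, ∑ s, z a s * d s l * (u l b * v l c) := Finset.sum_comm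
      _ = ∑ l, (∑ s, z a s * d s l) * u l b * v l c := by
          refine Finset.sum_congr rfl fun l _ => ?_
          rw [Finset.sum_mul, Finset.sum_mul]
          exact Finset.sum_congr rfl fun s _ => by ring
  -- the overlap is `cap`
  have hover : (∑ a, ∑ b, ∑ c, S a b c * matMulTensor ℂ 2 2 2 a b c) = (cap : ℂ) := by
    have h1 : ∀ a, (∑ b, ∑ c, S a b c * matMulTensor ℂ 2 2 2 a b c) = ∑ s, z a s * τ s a := by
      intro a
      rw [slice_sum_matMulTensor (S a) a]
      simp only [hSdef, hτ]
      rw [Finset.sum_comm]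
      exact Finset.sum_congr rfl fun s _ => by rw [Finset.mul_sum]
    simp_rw [h1]
    rw [hcap]
    push_cast
    rw [Finset.sum_comm]
    refine Finset.sum_congr rfl fun s _ => Finset.sum_congr rfl fun a _ => ?_
    simp only [hz, Complex.conj_mul']
  -- the norm is `cap`
  have hnorm : (∑ a, ∑ b, ∑ c, ‖S a b c‖ ^ 2) = cap := by
    have h1 : ∀ a, (∑ b, ∑ c, ‖S a b c‖ ^ 2) = ∑ s, ‖z a s‖ ^ 2 := fun a =>
      parseval_slice e he (z a) (S a) (fun b c => rfl)
    simp_rw [h1]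
    rw [hcap, Finset.sum_comm]
    refine Finset.sum_congr rfl fun s _ => Finset.sum_congr rfl fun a _ => ?_
    simp only [hz, Complex.norm_conj]
  -- apply the rung
  have key := hrung S hrank
  rw [hover, hnorm, Complex.norm_real, Real.norm_of_nonneg hcap0] at key
  -- `cap² ≤ C · cap`
  rcases hcap0.lt_or_eq with hpos | hzero
  · nlinarith
  · rw [← hzero]; exact hC

/-! ## From the capture bound to a rung -/

/-- **A capture bound on product `k`-planes gives the rung at rank `k`** (`k ≤ 16`): if every orthonormal
`k`-frame `e` lying in an honest product `k`-plane has `cap e ≤ C`, then `|⟨S,⟨2,2,2⟩⟩|² ≤ C‖S‖²` for every `S`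
of rank `≤ k` (product frame + the tree's exact output elimination `stub_sliceElimination`). [folklore] -/
theorem rung_of_cap {k : ℕ} (hk : k ≤ 16) {C : ℝ}
    (hcap : ∀ (u v : Fin k → (Fin 2 × Fin 2) → ℂ)
      (e : Fin k → (Fin 2 × Fin 2) → (Fin 2 × Fin 2) → ℂ),
      (∀ s t : Fin k, (∑ b, ∑ c, conj (e s b c) * e t b c) = if s = t then 1 else 0) →
      (∀ s, e s ∈ Submodule.span ℂ (Set.range fun l : Fin k => fun b c => u l b * v l c)) →
      ∑ s, ∑ a : Fin 2 × Fin 2, ‖∑ m : Fin 2, e s (a.1, m) (m, a.2)‖ ^ 2 ≤ C)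
    (S : (Fin 2 × Fin 2) → (Fin 2 × Fin 2) → (Fin 2 × Fin 2) → ℂ) (hS : tensorRank S ≤ k) :
    ‖∑ a, ∑ b, ∑ c, S a b c * matMulTensor ℂ 2 2 2 a b c‖ ^ 2 ≤ C * ∑ a, ∑ b, ∑ c, ‖S a b c‖ ^ 2 := by
  obtain ⟨w, u, v, hdec⟩ := exists_eq_sum_triad_of_tensorRank_le hS
  obtain ⟨u', v', e, he, hps, hprod⟩ := productFrame hk u v
  have hc : (∑ s, ∑ a : Fin 2 × Fin 2, ‖∑ m : Fin 2, e s (a.1, m) (m, a.2)‖ ^ 2) ≤ C :=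
    hcap u' v' e he hps
  have hslices : ∀ a : Fin 2 × Fin 2, S a ∈ Submodule.span ℂ (Set.range e) := by
    intro a
    rw [hdec]
    exact slice_mem_span e w u v hprod a
  have h1 := stub_sliceElimination e he S hslices
  have hnn : (0 : ℝ) ≤ ∑ a, ∑ b, ∑ c, ‖S a b c‖ ^ 2 := by positivity
  calc ‖∑ a, ∑ b, ∑ c, S a b c * matMulTensor ℂ 2 2 2 a b c‖ ^ 2
      ≤ (∑ a, ∑ b, ∑ c, ‖S a b c‖ ^ 2) *
          ∑ s, ∑ a : Fin 2 × Fin 2, ‖∑ m : Fin 2, e s (a.1, m) (m, a.2)‖ ^ 2 := h1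
    _ ≤ (∑ a, ∑ b, ∑ c, ‖S a b c‖ ^ 2) * C := mul_le_mul_of_nonneg_left hc hnn
    _ = C * ∑ a, ∑ b, ∑ c, ‖S a b c‖ ^ 2 := by ring

/-- **Rung ↔ capture bound** at every rank `k ≤ 16` and constant `C ≥ 0`:
`(M(2,k) ≤ C) ↔ (cap e ≤ C for every orthonormal k-frame e in an honest product k-plane)`. [folklore] -/
theorem rung_iff_cap {k : ℕ} (hk : k ≤ 16) {C : ℝ} (hC : 0 ≤ C) :
    (∀ S : (Fin 2 × Fin 2) → (Fin 2 × Fin 2) → (Fin 2 × Fin 2) → ℂ, tensorRank S ≤ k →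
      ‖∑ a, ∑ b, ∑ c, S a b c * matMulTensor ℂ 2 2 2 a b c‖ ^ 2 ≤ C * ∑ a, ∑ b, ∑ c, ‖S a b c‖ ^ 2) ↔
    ∀ (u v : Fin k → (Fin 2 × Fin 2) → ℂ) (e : Fin k → (Fin 2 × Fin 2) → (Fin 2 × Fin 2) → ℂ),
      (∀ s t : Fin k, (∑ b, ∑ c, conj (e s b c) * e t b c) = if s = t then 1 else 0) →
      (∀ s, e s ∈ Submodule.span ℂ (Set.range fun l : Fin k => fun b c => u l b * v l c)) →
      ∑ s, ∑ a : Fin 2 × Fin 2, ‖∑ m : Fin 2, e s (a.1, m) (m, a.2)‖ ^ 2 ≤ C :=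
  ⟨fun h u v e he hspan => cap_le_of_rung hC h u v e he hspan, fun h S hS => rung_of_cap hk h S hS⟩

/-- **Registered stub `stub_rungIffCap`** (raw form of `rung_iff_cap`): rung `M(2,k) ≤ C` ↔ capture bound
`cap e ≤ C` on honest product `k`-planes, for `k ≤ 16`, `C ≥ 0`. -/
theorem stub_rungIffCap : ∀ k : ℕ, k ≤ 16 → ∀ C : ℝ, 0 ≤ C → ((∀ S : (Fin 2 × Fin 2) → (Fin 2 × Fin 2) → (Fin 2 × Fin 2) → ℂ, tensorRank S ≤ k → ‖∑ a, ∑ b, ∑ c, S a b c * matMulTensor ℂ 2 2 2 a b c‖ ^ 2 ≤ C * ∑ a, ∑ b, ∑ c, ‖S a b c‖ ^ 2) ↔ ∀ (u v : Fin k → (Fin 2 × Fin 2) → ℂ) (e : Fin k → (Fin 2 × Fin 2) → (Fin 2 × Fin 2) → ℂ), (∀ s t : Fin k, (∑ b, ∑ c, (starRingEnd ℂ) (e s b c) * e t b c) = if s = t then 1 else 0) → (∀ s, e s ∈ Submodule.span ℂ (Set.range fun l : Fin k => fun b c => u l b * v l c)) → ∑ s, ∑ a : Fin 2 × Fin 2,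 ‖∑ m : Fin 2, e s (a.1, m) (m, a.2)‖ ^ 2 ≤ C) :=
  fun _ hk _ hC => rung_iff_cap hk hC

end Summit.MatrixMultiplication.MatrixMultiplication.Theorems.LinearDefectLaw.Caps

end
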